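import Summits.Ventures.PercRepro.TheoremNAll

/-!
# PercRepro — THE DIAGONAL `p = q + 2` OF C-025 IN THE DUAL: A NULLITY-1 / NULLITY-2 COUNT (p9, S4)

`proofs/SUBCLAIM-S4-p9.md` §GAP. The diagonal `p = q + 2` is the first open cell of every window. For a matroid `M` of rank
`q + 2` (the cell's truncation reduces every `p` to `ρ(E) = p`) and `A ⊆ E`, Mathlib's `eRk_dual_add_eRank`
(`M✶.eRk X + M.eRank = M.eRk (E ∖ X) + |X|`) turns the two counts into statements about the DUAL `N = M✶`:
* `ρ(A) = q + 2 ∧ ρ(E ∖ A) = q` ⟺ `E ∖ A` is independent in `N` and `A` has nullity `2` in `N` (`N.eRk A + 2 = |A|`);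
* `q < ρ(A) < q + 2` ⟺ `E ∖ A` has nullity `1` in `N` (`N.eRk (E ∖ A) + 1 = |E ∖ A|`);
and `Φ(q+2, q) = (q+2)/(q+1)`. So the diagonal reads: `(q+2)·#{A : E∖A ∈ I(N), nul_N(A) = 2} ≤ (q+1)·#{A : nul_N(E∖A) = 1}`
(`rls_diag_iff_dual`) — the count of nullity-2 sets with independent complement against the count of nullity-1 sets (the
sets containing exactly one circuit), a statement about the circuits of `N` with equality at `N = U_{q, 2q+2}`. Nothing here
closes a cell; it is the bridge. Axioms: standard.
-/

open scoped Matroid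

namespace PercRepro

namespace ThmN

open Set

variable {α : Type}

/-- `Φ(q + 2, q) = (q + 2)/(q + 1)`: the only `u` with `q < u < q + 2` is `q + 1`, and
`C(2q+2, q+2)·(q+2) = C(2q+2, q+1)·(q+1)`. -/
theorem phiK_diag (q : ℕ) : phiK (q + 2) q = ((q : ℚ) + 2) / ((q : ℚ) + 1) := by
  unfold phiK
  have hI : Finset.Ioo q (q + 2) = {q + 1} := by
    ext u; simp only [Finset.mem_Ioo, Finset.mem_singleton]; omega
  rw [hI, Finset.sum_singleton]
  have h := Nat.choose_succ_right_eq (q + 2 + q) (q + 1)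
  rw [show q + 2 + q - (q + 1) = q + 1 by omega] at h
  have hpos : 0 < (q + 2 + q).choose (q + 2) := Nat.choose_pos (by omega)
  have hq : ((q + 2 + q).choose (q + 2) : ℚ) * ((q : ℚ) + 2) = ((q + 2 + q).choose (q + 1) : ℚ) * ((q : ℚ) + 1) := by
    have : ((q + 2 + q).choose (q + 1 + 1) * (q + 1 + 1) : ℕ) = (q + 2 + q).choose (q + 1) * (q + 1) := h
    exact_mod_cast this
  have hposq : (0 : ℚ) < ((q + 2 + q).choose (q + 2) : ℚ) := by exact_mod_cast hpos
  rw [div_eq_div_iff hposq.ne' (by positivity)]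
  linarith

/-- On a finite matroid every rank is finite. -/
theorem eRk_ne_top_of_finite (M : Matroid α) [M.Finite] (X : Set α) (hX : X ⊆ M.E) : M.eRk X ≠ ⊤ := by
  have h1 := M.eRk_le_encard X
  have h2 : X.encard ≠ ⊤ := (M.ground_finite.subset hX).encard_lt_top.ne
  exact ne_top_of_le_ne_top h2 h1

/-- **THE DUAL EQUATIONS at rank `q + 2`**, in `ℕ`: for `A ⊆ E` with `a = ρ(A)`, `b = ρ(E∖A)`, `a′ = ρ*(A)`,
`b′ = ρ*(E∖A)`, `n = |A|`, `m = |E∖A|`: `a′ + (q + 2) = b + n` and `b′ + (q + 2) = a + m`. -/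
theorem dual_eqs (M : Matroid α) [M.Finite] {q : ℕ} (hR : M.eRank = ((q + 2 : ℕ) : ℕ∞)) {A : Set α}
    (hA : A ⊆ M.E) :
    ∃ a b a' b' n m : ℕ, M.eRk A = a ∧ M.eRk (M.E \ A) = b ∧ M✶.eRk A = a' ∧ M✶.eRk (M.E \ A) = b' ∧
      A.encard = n ∧ (M.E \ A).encard = m ∧ a' + (q + 2) = b + n ∧ b' + (q + 2) = a + m := by
  have hAc : M.E \ A ⊆ M.E := sdiff_subset
  have hAfin : A.Finite := M.ground_finite.subset hA
  have hAcfin : (M.E \ A).Finite := M.ground_finite.subset hAc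
  obtain ⟨a, ha⟩ := ENat.ne_top_iff_exists.1 (eRk_ne_top_of_finite M A hA)
  obtain ⟨b, hb⟩ := ENat.ne_top_iff_exists.1 (eRk_ne_top_of_finite M (M.E \ A) hAc)
  have hA' : A ⊆ M✶.E := by rw [Matroid.dual_ground]; exact hA
  have hAc' : M.E \ A ⊆ M✶.E := by rw [Matroid.dual_ground]; exact hAc
  obtain ⟨a', ha'⟩ := ENat.ne_top_iff_exists.1 (eRk_ne_top_of_finite M✶ A hA')
  obtain ⟨b', hb'⟩ := ENat.ne_top_iff_exists.1 (eRk_ne_top_of_finite M✶ (M.E \ A) hAc')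
  refine ⟨a, b, a', b', A.ncard, (M.E \ A).ncard, ha.symm, hb.symm, ha'.symm, hb'.symm, hAfin.cast_ncard_eq.symm,
    hAcfin.cast_ncard_eq.symm, ?_, ?_⟩
  · have h := M.eRk_dual_add_eRank A hA
    rw [← ha', hR, ← hb, ← hAfin.cast_ncard_eq] at h
    exact_mod_cast h
  · have h := M.eRk_dual_add_eRank (M.E \ A) hAc
    rw [sdiff_sdiff_cancel_left hA, ← hb', hR, ← ha, ← hAcfin.cast_ncard_eq] at h
    exact_mod_cast h

/-- The `U`-set of the diagonal in the dual: `ρ(A) = q + 2 ∧ ρ(E∖A) = q` ⟺ `E ∖ A ∈ I(M✶)` and `ρ*(A) + 2 = |A|`. -/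
theorem U_diag_eq (M : Matroid α) [M.Finite] {q : ℕ} (hR : M.eRank = ((q + 2 : ℕ) : ℕ∞)) :
    {A : Set α | A ⊆ M.E ∧ M.eRk A = ((q + 2 : ℕ) : ℕ∞) ∧ M.eRk (M.E \ A) = (q : ℕ∞)} =
      {A : Set α | A ⊆ M.E ∧ M✶.Indep (M.E \ A) ∧ M✶.eRk A + 2 = A.encard} := by
  ext A
  simp only [mem_setOf_eq]
  constructor
  · rintro ⟨hA, h1, h2⟩
    obtain ⟨a, b, a', b', n, m, ha, hb, ha', hb', hn, hm, e1, e2⟩ := dual_eqs M hR hA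
    have hAcfin : (M.E \ A).Finite := M.ground_finite.subset sdiff_subset
    rw [ha] at h1; rw [hb] at h2
    have ha2 : a = q + 2 := by exact_mod_cast h1
    have hb2 : b = q := by exact_mod_cast h2
    refine ⟨hA, ?_, ?_⟩
    · rw [Matroid.indep_iff_eRk_eq_encard_of_finite hAcfin, hb', hm]
      have : b' = m := by omega
      rw [this]
    · rw [ha', hn]
      have : a' + 2 = n := by omega
      exact_mod_cast this
  · rintro ⟨hA, h1, h2⟩
    obtain ⟨a, b, a', b', n, m, ha, hb, ha', hb', hn, hm, e1, e2⟩ := dual_eqs M hR hA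
    have hAcfin : (M.E \ A).Finite := M.ground_finite.subset sdiff_subset
    rw [Matroid.indep_iff_eRk_eq_encard_of_finite hAcfin, hb', hm] at h1
    rw [ha', hn] at h2
    have hb'm : b' = m := by exact_mod_cast h1
    have ha'n : a' + 2 = n := by exact_mod_cast h2
    refine ⟨hA, ?_, ?_⟩
    · rw [ha]; have : a = q + 2 := by omega
      rw [this]
    · rw [hb]; have : b = q := by omega
      rw [this]

/-- The `Y`-set of the diagonal in the dual: `q < ρ(A) < q + 2` ⟺ `ρ*(E∖A) + 1 = |E∖A|` (`E ∖ A` has nullity `1`). -/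
theorem Y_diag_eq (M : Matroid α) [M.Finite] {q : ℕ} (hR : M.eRank = ((q + 2 : ℕ) : ℕ∞)) :
    {A : Set α | A ⊆ M.E ∧ (q : ℕ∞) < M.eRk A ∧ M.eRk A < ((q + 2 : ℕ) : ℕ∞)} =
      {A : Set α | A ⊆ M.E ∧ M✶.eRk (M.E \ A) + 1 = (M.E \ A).encard} := by
  ext A
  simp only [mem_setOf_eq]
  constructor
  · rintro ⟨hA, h1, h2⟩
    obtain ⟨a, b, a', b', n, m, ha, hb, ha', hb', hn, hm, e1, e2⟩ := dual_eqs M hR hA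
    rw [ha] at h1 h2
    have h1' : q < a := by exact_mod_cast h1
    have h2' : a < q + 2 := by exact_mod_cast h2
    refine ⟨hA, ?_⟩
    rw [hb', hm]
    have : b' + 1 = m := by omega
    exact_mod_cast this
  · rintro ⟨hA, h1⟩
    obtain ⟨a, b, a', b', n, m, ha, hb, ha', hb', hn, hm, e1, e2⟩ := dual_eqs M hR hA
    rw [hb', hm] at h1
    have h1' : b' + 1 = m := by exact_mod_cast h1
    refine ⟨hA, ?_, ?_⟩
    · rw [ha]; exact_mod_cast (show q < a by omega)
    · rw [ha]; exact_mod_cast (show a < q + 2 by omega)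

/-- **THE DIAGONAL `p = q + 2` OF C-025 IN THE DUAL**: for `M` of rank `q + 2`,
`RLS M (q+2) q ↔ (q+2)·#{A ⊆ E : E∖A ∈ I(M✶), ρ*(A) + 2 = |A|} ≤ (q+1)·#{A ⊆ E : ρ*(E∖A) + 1 = |E∖A|}`
— nullity-`2` sets with independent complement against nullity-`1` sets, in the dual. -/
theorem rls_diag_iff_dual (M : Matroid α) [M.Finite] (q : ℕ) (hR : M.eRank = ((q + 2 : ℕ) : ℕ∞)) :
    RLS M (q + 2) q ↔
      ((q : ℚ) + 2) * ({A : Set α | A ⊆ M.E ∧ M✶.Indep (M.E \ A) ∧ M✶.eRk A + 2 = A.encard}.ncard : ℚ) ≤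
        ((q : ℚ) + 1) * ({A : Set α | A ⊆ M.E ∧ M✶.eRk (M.E \ A) + 1 = (M.E \ A).encard}.ncard : ℚ) := by
  unfold RLS
  rw [phiK_diag, U_diag_eq M hR, Y_diag_eq M hR]
  have hpos : (0 : ℚ) < (q : ℚ) + 1 := by positivity
  rw [div_mul_eq_mul_div, div_le_iff₀ hpos]
  constructor <;> intro h <;> linarith

end ThmN

end PercRepro
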